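/-
Copyright (c) 2026. All rights reserved.
Released under Apache 2.0 license as described in the file LICENSE.
Authors: abc-iut cell, discharge seat abc-iut-w4-d095 (wave 4, gen 3).
-/
import Mathlib.Algebra.Category.Grp.Preadditive
import Mathlib.CategoryTheory.Types.Basic
import Literature.AnabelianGeometry.AbsoluteAnabelian.LogFrobeniusRigidity
import HarnessLib

/-!
# [AbsTopIII] Corollary 5.5 (v), second clause ("`D•` is totally `□`-rigid", `Cor55CoreRigid`, FACT-LIST F-0155): kernel calibration — satisfiable at one setting, refutable at another

S. Mochizuki, *Topics in absolute anabelian geometry III: global reconstruction algorithms*,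
J. Math. Sci. Univ. Tokyo 22 (2015) 939–1156 [MochizukiAbsTopIII2015]; locators `p.N` = pages of the
author's manuscript (`paper:url-5493eb38cbb7`): §0 p. 27 (rigid functors, id-rigid categories), Def 3.5 (vi) p. 77
(totally `□`-rigid), Cor 5.5 (v) pp. 131–133.

PROOF-ONLY companion of `LogFrobeniusRigidity.lean` (abc-iut-L4-t3 / abc-iut-w5-d112: the `Prop`
`LogFrobeniusSetting.Cor55CoreRigid` and its REDUCTION `cor55CoreRigid_iff : L.Cor55CoreRigid ↔ IsIdRigid L.X` to the
id-rigidity of the one category `𝒳 = Th•_T[Z]`).  Two kernel facts calibrating the TYPED statement (same method as this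
seat's F-0141 calibration, `LogFrobeniusLogWallNonVacuity.lean` / `LogFrobeniusLogWallIndependence.lean`):

* `LogFrobeniusSetting.exists_cor55CoreRigid` — over every index set there is a setting at which `Cor55CoreRigid` HOLDS:
  the diagonal setting (all rows one large category, all structure functors identities, all 2-cells identities) on the
  id-rigid large category `Type u` of sets (`isIdRigid_type`: a natural automorphism of `𝟭 (Type u)` is the identity —
  test it against the constant maps `PUnit ⟶ X`).
* `LogFrobeniusSetting.exists_not_cor55CoreRigid` — … and one at which it FAILS: the diagonal setting on the category
  of abelian groups `AddCommGrpCat.{u}`, whose identity functor has the non-trivial natural automorphism "negation"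
  (`not_isIdRigid_addCommGrpCat`, witnessed at `ℤ`: `-1 ≠ 1`).

(The tree's genuine id-rigid category of record, abc-iut-L4-t9's slim MLF-Galois-pair model `TFModel.Slim p`
— `TFModel.isIdRigid_slim`, Prop 3.2 (iv) at the model — is `Category.{1}` on `Type 1`, objects and morphisms in one
universe, so it does not fit the large-category signature `(Type (u+1), Category.{u})` of `LogFrobeniusSetting`;
hence the set-theoretic `Type u` here.)  So F-0155 is INDEPENDENT of the interface `LogFrobeniusSetting` in OUR kernel: it asserts a genuine property of print's
category `Th•_T[Z]` (id-rigidity, [AbsTopIII] §0 / Cor 5.5 (v) p. 133 "immediate from the definitions") and is correctly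
carried as a named hypothesis; nothing about print is impugned.  HONEST LABEL: both settings are DEGENERATE
calibration devices with no arithmetic content.  Refereed pre-IUT anabelian geometry; nothing here bears on
[IUTchIII] Cor. 3.12; typed ≠ proved.
-/

universe u

open CategoryTheory

namespace Literature.AnabelianGeometry.AbsoluteAnabelian

/-! ## Two large categories: one id-rigid, one not -/

/-- **The category of sets `Type u` is id-rigid** (§0 p. 27): a natural automorphism `α` of `𝟭 (Type u)` is the
identity — naturality against the constant map `PUnit ⟶ X` with value `x` gives `α_X x = x` (an EXAMPLE of the printed
notion "id-rigid", §0 p. 27; elementary). [cite: MochizukiAbsTopIII2015, Section 0 p.27] -/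
theorem isIdRigid_type : IsIdRigid (Type u) := by
  intro α
  ext X x
  have h := ConcreteCategory.congr_hom (α.hom.naturality (TypeCat.ofHom (fun _ : PUnit.{u + 1} => x)))
    PUnit.unit
  exact h

/-- Negation is a natural automorphism of the identity functor of `AddCommGrpCat`. [folklore] -/
private theorem neg_naturality {M N : AddCommGrpCat.{u}} (f : M ⟶ N) :
    (𝟭 AddCommGrpCat.{u}).map f ≫ (-𝟙 N : N ⟶ N) = (-𝟙 M : M ⟶ M) ≫ (𝟭 AddCommGrpCat.{u}).map f := by
  simp [Preadditive.comp_neg, Preadditive.neg_comp]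

/-- **The category of abelian groups `AddCommGrpCat.{u}` is NOT id-rigid** (§0 p. 27): negation `x ↦ -x` is a natural
automorphism of the identity functor different from the identity (at `ℤ`, `-1 ≠ 1`) — a NON-EXAMPLE of the
printed notion "id-rigid", §0 p. 27; elementary. [cite: MochizukiAbsTopIII2015, Section 0 p.27] -/
theorem not_isIdRigid_addCommGrpCat : ¬ IsIdRigid AddCommGrpCat.{u} := by
  intro h
  -- the natural automorphism "negation" of `𝟭 AddCommGrpCat`
  let ν : 𝟭 AddCommGrpCat.{u} ≅ 𝟭 AddCommGrpCat.{u} :=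
    { hom := { app := fun M => -𝟙 M, naturality := fun _ _ f => neg_naturality f }
      inv := { app := fun M => -𝟙 M, naturality := fun _ _ f => neg_naturality f }
      hom_inv_id := by ext M : 2; simp
      inv_hom_id := by ext M : 2; simp }
  have hν := congrArg (fun β : 𝟭 AddCommGrpCat.{u} ≅ 𝟭 _ => β.hom.app (AddCommGrpCat.of (ULift.{u} ℤ))) (h ν)
  -- evaluate at `1 : ℤ`: `-1 = 1`, absurd
  have h1 := congrArg (fun f : AddCommGrpCat.of (ULift.{u} ℤ) ⟶ AddCommGrpCat.of (ULift.{u} ℤ) =>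
    (f.hom (ULift.up 1)).down) hν
  simp [ν] at h1

namespace LogFrobeniusSetting

variable (Vmod : Type u) (isArc : Vmod → Bool)

/-- `Λ_ν ∘ 𝟭 = 𝟭` for `log = 𝟭` (the typing of `ι⊞_{v,ε}` at the diagonal setting).
[cite: MochizukiAbsTopIII2015, Def 5.4 (vii) p. 128] -/
private theorem frobeniusTwist_id_comp_id' {C : Type (u + 1)} [Category.{u} C] (b : Bool) :
    frobeniusTwist (𝟭 C) b ⋙ 𝟭 C = 𝟭 C := by
  cases b <;> rfl

/-- For every large category `C` there is a setting with `𝒳 = C` whose total `□`-rigidity is EQUIVALENT to the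
id-rigidity of `C` (the diagonal setting on `C`, through abc-iut-w5-d112's reduction `cor55CoreRigid_iff`).
[cite: MochizukiAbsTopIII2015, Cor 5.5 (v) p. 133] -/
theorem exists_cor55CoreRigid_iff_isIdRigid (C : Type (u + 1)) [Category.{u} C] :
    ∃ L : LogFrobeniusSetting Vmod isArc, L.X = C ∧ (L.Cor55CoreRigid ↔ IsIdRigid C) := by
  let L₀ : LogFrobeniusSetting Vmod isArc :=
    { X := C
      E := C
      proj := 𝟭 C
      log := 𝟭 C
      logIsoId := Iso.refl _
      logOver := Iso.refl _
      Nplus := fun _ => C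
      N := fun _ => C
      forget := fun _ => 𝟭 C
      toE := fun _ => 𝟭 C
      lam := fun _ _ => 𝟭 C
      lamOver := fun _ _ => Iso.refl _
      lam_spaceLink_eq_postLog := fun _ => rfl
      iota := fun _ ν₁ _ _ => eqToHom (frobeniusTwist_id_comp_id' ν₁.isPostLog)
      An := C
      κAn := CategoryTheory.Equivalence.refl
      φAn := 𝟭 C
      φAn_isEquivalence := inferInstance
      ηAn := Iso.refl _
      κAn₂ := CategoryTheory.Equivalence.refl
      Emono := C
      monoAn := 𝟭 C
      NmonoPlus := fun _ => C
      Nmono := fun _ => C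
      forgetMono := fun _ => 𝟭 C
      toEmono := fun _ => 𝟭 C
      monoNplus := fun _ => 𝟭 C
      monoN := fun _ => 𝟭 C
      monoHomotopy := fun _ => Iso.refl _
      AnMono := C
      κAnMono := CategoryTheory.Equivalence.refl
      ψAnMono := fun _ _ => 𝟭 C }
  exact ⟨L₀, rfl, L₀.cor55CoreRigid_iff⟩

/-- **`Cor55CoreRigid` (F-0155) is satisfiable over every index set**: the diagonal setting on the id-rigid category
`Type u`.  DEGENERATE calibration witness. [cite: MochizukiAbsTopIII2015, Cor 5.5 (v) p. 131] -/
theorem exists_cor55CoreRigid : ∃ L : LogFrobeniusSetting Vmod isArc, L.Cor55CoreRigid := by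
  obtain ⟨L, -, hL⟩ := exists_cor55CoreRigid_iff_isIdRigid Vmod isArc (Type u)
  exact ⟨L, hL.mpr isIdRigid_type⟩

/-- **`Cor55CoreRigid` (F-0155) is refutable at some setting over every index set**: the diagonal setting on
`AddCommGrpCat.{u}` (negation is a non-trivial natural automorphism of the identity).  With `exists_cor55CoreRigid`:
F-0155 is independent of the interface `LogFrobeniusSetting` — a genuine property of print's `Th•_T[Z]`, correctly a
named hypothesis.  DEGENERATE calibration witness. [cite: MochizukiAbsTopIII2015, Cor 5.5 (v) p. 131] -/
theorem exists_not_cor55CoreRigid : ∃ L : LogFrobeniusSetting Vmod isArc, ¬ L.Cor55CoreRigid := by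
  obtain ⟨L, -, hL⟩ := exists_cor55CoreRigid_iff_isIdRigid Vmod isArc AddCommGrpCat.{u}
  exact ⟨L, fun h => not_isIdRigid_addCommGrpCat (hL.mp h)⟩

/-- Hence also **`Cor55Rigidity` (F-0156 = total `□`-rigidity ∧ the `ℤ`-action clause) is refutable at some setting**
(its first conjunct fails there). [cite: MochizukiAbsTopIII2015, Cor 5.5 (v) p. 131] -/
theorem exists_not_cor55Rigidity : ∃ L : LogFrobeniusSetting Vmod isArc, ¬ L.Cor55Rigidity := by
  obtain ⟨L, hL⟩ := exists_not_cor55CoreRigid Vmod isArc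
  exact ⟨L, fun h => hL h.1⟩

end LogFrobeniusSetting

end Literature.AnabelianGeometry.AbsoluteAnabelian
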